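import Summits.SmoothPoincare4.SmoothPoincare4.Theorems.ConvexBisectionAcyclicBisectionExistsDualHandleModelMap
import Mathlib.Analysis.Calculus.LocalExtr.Basic
import HarnessLib

/-!
# Dual handles, X: the cocore neighbourhood `N`, the dome, and the model function `H` — definitions
(brick (F-image)+(H), definitions file, of the sub-goal T3b "the complement of the prefix
sub-handlebody is the other piece with the DUAL suffix handles" of stub `stub_steinRealisation`
(NF6), line `modp-braid-orbits` r11, crux `ConvexBisection.AcyclicBisectionExists`,
item stmt-SmoothPoincare4-10508; wave 3, lead c5, worker Z2)

Model coordinates of the `j`-th handle (`…DualHandleModelMap.lean`): `x = (x_λ, x_μ) ∈ ℝ⁴`,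
`P = ‖lamPart x‖²`, `Q = ‖muPart x‖²`, `r² = P + Q`; handle side `{r ≤ 1}`, seam `{r = 1}`, belt
circle `{P = 0, r = 1}`, cocore disc `{P = 0, r ≤ 1}`.  The model dual handle map
`𝓕 = modelF a κ δ` acts on the squared part-norms by `(s, u) ↦ (u·𝓅(s), s·q̃(s,u))`; its image on
`D⁴ ∖ S` is `Dome ∪ N` (`…DualHandleModelImage.lean`).  This file fixes the explicit objects:

* `slabCut s = S(4s - 1)` (`0` on `s ≤ 1/4`, `1` on `s ≥ 1/2`), flat-top derivative lemmas
  `hasDerivAt_slabCut_of_ge`, `hasDerivAt_coreCut_of_ge`, `hasDerivAt_pFun` (`𝓅' = κ²` on `s ≥ 1/4`);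
* **`cocoreCurve κ δ P = ω(P/κ²)(1 - P) + (1 - ω(P/κ²)) δP/κ²`** (`ω = shellCut`): the upper
  boundary curve `Q = 𝒸(P)` of `N` (`= δP/κ²` for `P ≤ κ²/2`, `= 1 - P` for `P ≥ 3κ²/4`);
* **`cocoreNbhd κ δ = N = {‖x‖ ≤ 1, (Q ≤ δ/2 ∧ P ≤ 𝓅(Q/δ)) ∨ (δ/4 ≤ Q ∧ P ≤ 3κ²/4 ∧ 𝒸(P) ≤ Q)}`**
  (V5 report §3.2, verbatim): a closed neighbourhood of the cocore disc in `{r ≤ 1} ∖ {P = 1}`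
  (`closedBall_inter_subset_cocoreNbhd`: `{r ≤ 1, P ≤ κ²/16} ⊆ N`), meeting the seam in
  `{r = 1, P ≤ 3κ²/4}` (`mem_cocoreNbhd_iff_of_norm_eq_one`);
* **`dualDome a κ δ = {P < κ², 1 ≤ r², r² < 1 + g(δ(1 - P/κ²))}`** (`= Π(T)`, V5 report §3.0);
* **`modelHFun κ δ P Q = (1 - χ̄(Q/δ))(P - 𝓅(Q/δ)) + χ̄(Q/δ)(𝒸(P) - Q)`**, `χ̄ = slabCut`, and
  **`modelH κ δ x = modelHFun κ δ P Q`**: smooth on `ℝ⁴` (`contDiff_modelH`), `= P - 𝓅(Q/δ)` on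
  `Q ≤ δ/4`, `= 𝒸(P) - Q` on `Q ≥ δ/2`, a positive multiple of `δP/κ² - Q` on the line zone
  `δ/4 ≤ Q ≤ δ/2, P ≤ κ²/2` (`modelHFun_line`), **`= 1 - ‖x‖²` on the plateau `P ≥ 3κ²/4, Q ≥ δ/2`**
  (`modelH_eq_one_sub_norm_sq`, registered as `helper_modelH_plateau`) and `≤ 1 - ‖x‖²` on `Q ≥ δ/2`.

The set identities `N = {‖x‖ ≤ 1, H ≤ 0, P ≤ 3κ²/4}`, the regularity of the zero set of `H` and
the image theorem are in the sequels `…DualHandleModelRegion.lean`, `…DualHandleModelImage.lean`.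
Constants as in `…DualHandleModelInj.lean`: `0 < κ ≤ 1/2`, `0 < δ ≤ 1/2` (so `κ² + δ < 1`), `0 < a`.
Everything here is proved; no named facts.

## References
* J. Milnor, *Lectures on the h-cobordism theorem* (1965), §3 (dual handles). [MilnorHCobordism1965]
* A. A. Kosinski, *Differential Manifolds* (1993), VI §6. [Kosinski1993]
-/

noncomputable section

-- the prescribed namespace `Summit.<P>.<Sub>.…` duplicates `SmoothPoincare4` (P = Sub)
set_option linter.dupNamespace false

open scoped Manifold ContDiff Topology

namespace Summit.SmoothPoincare4.SmoothPoincare4.Theorems.AcyclicBisectionExists.ModpBraidOrbits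

open Set Function Metric
open Literature.Topology.FourManifolds Literature.Topology.FourManifolds.HandleAttachingMap

/-! ### §1 The slab cut-off and flat-top derivatives -/

section SlabCut

/-- The slab cut-off `χ̄ s = S(4s - 1)`: `0` for `s ≤ 1/4`, `1` for `s ≥ 1/2`. [folklore] -/
def slabCut (s : ℝ) : ℝ := Real.smoothTransition (4 * s - 1)

/-- `χ̄ = 0` on `s ≤ 1/4`. [folklore] -/
theorem slabCut_of_le {s : ℝ} (hs : s ≤ 1 / 4) : slabCut s = 0 :=
  Real.smoothTransition.zero_of_nonpos (by linarith)

/-- `χ̄ = 1` on `s ≥ 1/2`. [folklore] -/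
theorem slabCut_of_ge {s : ℝ} (hs : 1 / 2 ≤ s) : slabCut s = 1 :=
  Real.smoothTransition.one_of_one_le (by linarith)

/-- `0 ≤ χ̄ ≤ 1`. [folklore] -/
theorem slabCut_mem (s : ℝ) : 0 ≤ slabCut s ∧ slabCut s ≤ 1 :=
  ⟨Real.smoothTransition.nonneg _, Real.smoothTransition.le_one _⟩

/-- `χ̄ < 1` on `s < 1/2`. [folklore] -/
theorem slabCut_lt_one {s : ℝ} (hs : s < 1 / 2) : slabCut s < 1 :=
  Real.smoothTransition.lt_one_of_lt_one (by linarith)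

/-- `χ̄` is smooth. [folklore] -/
theorem contDiff_slabCut : ContDiff ℝ ∞ slabCut :=
  Real.smoothTransition.contDiff.comp ((contDiff_const.mul contDiff_id).sub contDiff_const)

/-- Flat top of `χ̄`: `χ̄' s = 0` for `s ≥ 1/2` (a global maximum). [folklore] -/
theorem hasDerivAt_slabCut_of_ge {s : ℝ} (hs : 1 / 2 ≤ s) : HasDerivAt slabCut 0 s := by
  have hmax : IsLocalMax slabCut s :=
    Filter.Eventually.of_forall fun t => by rw [slabCut_of_ge hs]; exact (slabCut_mem t).2
  rw [← hmax.deriv_eq_zero]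
  exact ((contDiff_slabCut.differentiable (by simp)) s).hasDerivAt

/-- Flat top of `ω₁ = coreCut`: `ω₁' s = 0` for `s ≥ 1/4`. [folklore] -/
theorem hasDerivAt_coreCut_of_ge {s : ℝ} (hs : 1 / 4 ≤ s) : HasDerivAt coreCut 0 s := by
  have hmax : IsLocalMax coreCut s :=
    Filter.Eventually.of_forall fun t => by rw [coreCut_of_ge hs]; exact (coreCut_mem t).2
  rw [← hmax.deriv_eq_zero]
  exact ((contDiff_cutLam.differentiable (by simp)) s).hasDerivAt

/-- `𝓅' = κ²` on `s ≥ 1/4` (including the flat end point `s = 1/4`). [folklore] -/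
theorem hasDerivAt_pFun (κ : ℝ) {s : ℝ} (hs : 1 / 4 ≤ s) : HasDerivAt (pFun κ) (κ ^ 2) s := by
  have h := ((hasDerivAt_id s).add (((hasDerivAt_coreCut_of_ge hs).const_sub 1).div_const 8)).const_mul
    (κ ^ 2)
  have h' : κ ^ 2 * (1 + -0 / 8) = κ ^ 2 := by ring
  rw [h'] at h
  exact h

/-- `𝓅 ≤ 5κ²/8` on `0 ≤ s ≤ 1/2`. [folklore] -/
theorem pFun_le {κ s : ℝ} (hs : s ≤ 1 / 2) : pFun κ s ≤ 5 * κ ^ 2 / 8 := by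
  unfold pFun
  have h0 := (coreCut_mem s).1
  nlinarith [sq_nonneg κ]

/-- `κ²/16 ≤ 𝓅` on `0 ≤ s` (`S(1/2) = 1/2`). [folklore] -/
theorem pFun_ge {κ s : ℝ} (hs : 0 ≤ s) : κ ^ 2 / 16 ≤ pFun κ s := by
  unfold pFun
  have h1 := (coreCut_mem s).2
  rcases le_or_gt s (1 / 8) with h | h
  · have hhalf : Real.smoothTransition (1 / 2) = 1 / 2 := by
      unfold Real.smoothTransition
      rw [show (1 : ℝ) - 1 / 2 = 1 / 2 by norm_num]
      have he : 0 < expNegInvGlue (1 / 2 : ℝ) := expNegInvGlue.pos_of_pos (by norm_num)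
      field_simp
      ring
    have h2 : coreCut s ≤ 1 / 2 := by
      rw [← hhalf]; exact Real.smoothTransition.monotone (by linarith)
    nlinarith [sq_nonneg κ]
  · nlinarith [sq_nonneg κ]

end SlabCut

/-! ### §2 The upper boundary curve `Q = 𝒸(P)` of the cocore neighbourhood -/

section Curve

/-- **`𝒸(P) = ω(P/κ²)(1 - P) + (1 - ω(P/κ²)) δP/κ²`**: the squared `μ`-norm of `𝓕` along `u = 1`
read over `P = κ² s`, `s ≥ 1/4` (V5 report §3.2). [cite: MilnorHCobordism1965, §3] -/
def cocoreCurve (κ δ P : ℝ) : ℝ :=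
  shellCut (P / κ ^ 2) * (1 - P) + (1 - shellCut (P / κ ^ 2)) * (δ * P / κ ^ 2)

/-- `𝒸(P) = δP/κ²` for `P ≤ κ²/2`. [folklore] -/
theorem cocoreCurve_of_le {κ δ P : ℝ} (hκ : 0 < κ) (hP : P ≤ κ ^ 2 / 2) :
    cocoreCurve κ δ P = δ * P / κ ^ 2 := by
  have hκ2 : 0 < κ ^ 2 := by positivity
  have : P / κ ^ 2 ≤ 1 / 2 := by rw [div_le_iff₀ hκ2]; linarith
  rw [cocoreCurve, shellCut_of_le this]; ring

/-- `𝒸(P) = 1 - P` for `P ≥ 3κ²/4`. [folklore] -/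
theorem cocoreCurve_of_ge {κ δ P : ℝ} (hκ : 0 < κ) (hP : 3 * κ ^ 2 / 4 ≤ P) :
    cocoreCurve κ δ P = 1 - P := by
  have hκ2 : 0 < κ ^ 2 := by positivity
  have : 3 / 4 ≤ P / κ ^ 2 := by rw [le_div_iff₀ hκ2]; linarith
  rw [cocoreCurve, shellCut_of_ge this]; ring

/-- `𝒸(P)` is a convex combination of `1 - P` and `δP/κ²`: it is at least their minimum.
[folklore] -/
theorem min_le_cocoreCurve (κ δ P : ℝ) : min (1 - P) (δ * P / κ ^ 2) ≤ cocoreCurve κ δ P := by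
  unfold cocoreCurve
  have h0 := (shellCut_mem (P / κ ^ 2)).1
  have h1 := (shellCut_mem (P / κ ^ 2)).2
  nlinarith [min_le_left (1 - P) (δ * P / κ ^ 2), min_le_right (1 - P) (δ * P / κ ^ 2)]

/-- … and at most their maximum. [folklore] -/
theorem cocoreCurve_le_max (κ δ P : ℝ) : cocoreCurve κ δ P ≤ max (1 - P) (δ * P / κ ^ 2) := by
  unfold cocoreCurve
  have h0 := (shellCut_mem (P / κ ^ 2)).1
  have h1 := (shellCut_mem (P / κ ^ 2)).2
  nlinarith [le_max_left (1 - P) (δ * P / κ ^ 2), le_max_right (1 - P) (δ * P / κ ^ 2)]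

/-- **`𝒸(P) ≤ 1 - P`** (`0 < κ ≤ 1/2`, `0 ≤ δ ≤ 1/2`): the curve lies below the seam.
[folklore] -/
theorem cocoreCurve_le_one_sub {κ δ P : ℝ} (hκ : 0 < κ) (hκ2 : κ ≤ 1 / 2) (hδ : 0 ≤ δ)
    (hδ2 : δ ≤ 1 / 2) : cocoreCurve κ δ P ≤ 1 - P := by
  rcases le_or_gt (3 * κ ^ 2 / 4) P with h | h
  · rw [cocoreCurve_of_ge hκ h]
  · have hκ2' : 0 < κ ^ 2 := by positivity
    have h1 : δ * P / κ ^ 2 ≤ 1 - P := by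
      rw [div_le_iff₀ hκ2']
      have : κ ^ 2 ≤ 1 / 4 := by nlinarith
      nlinarith
    calc cocoreCurve κ δ P ≤ max (1 - P) (δ * P / κ ^ 2) := cocoreCurve_le_max κ δ P
      _ = 1 - P := max_eq_left h1

/-- **`δ/2 < 𝒸(P)`** for `κ²/2 < P < 1 - δ/2` (`0 < δ`). [folklore] -/
theorem half_lt_cocoreCurve {κ δ P : ℝ} (hκ : 0 < κ) (hδ : 0 < δ) (hP : κ ^ 2 / 2 < P)
    (hP1 : P < 1 - δ / 2) : δ / 2 < cocoreCurve κ δ P := by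
  have hκ2 : 0 < κ ^ 2 := by positivity
  have h1 : δ / 2 < δ * P / κ ^ 2 := by rw [lt_div_iff₀ hκ2]; nlinarith
  have h2 : δ / 2 < 1 - P := by linarith
  exact lt_of_lt_of_le (lt_min h2 h1) (min_le_cocoreCurve κ δ P)

/-- `𝒸` is smooth. [folklore] -/
theorem contDiff_cocoreCurve (κ δ : ℝ) : ContDiff ℝ ∞ (cocoreCurve κ δ) := by
  unfold cocoreCurve
  have h1 : ContDiff ℝ ∞ fun P : ℝ => shellCut (P / κ ^ 2) := contDiff_cutTop.comp (contDiff_id.div_const _)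
  exact (h1.mul (contDiff_const.sub contDiff_id)).add
    ((contDiff_const.sub h1).mul ((contDiff_const.mul contDiff_id).div_const _))

end Curve

/-! ### §3 The cocore neighbourhood `N` and the dome -/

section Region

/-- **THE COCORE NEIGHBOURHOOD `N`** (V5 report §3.2):
`{‖x‖ ≤ 1, (Q ≤ δ/2 ∧ P ≤ 𝓅(Q/δ)) ∨ (δ/4 ≤ Q ∧ P ≤ 3κ²/4 ∧ 𝒸(P) ≤ Q)}` — the part of the image of
the model dual handle map inside the handle `{r ≤ 1}`. [cite: MilnorHCobordism1965, §3] -/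
def cocoreNbhd (κ δ : ℝ) : Set (EuclideanSpace ℝ (Fin 4)) :=
  {x | ‖x‖ ≤ 1 ∧
    ((‖muPart x‖ ^ 2 ≤ δ / 2 ∧ ‖lamPart x‖ ^ 2 ≤ pFun κ (‖muPart x‖ ^ 2 / δ)) ∨
      (δ / 4 ≤ ‖muPart x‖ ^ 2 ∧ ‖lamPart x‖ ^ 2 ≤ 3 * κ ^ 2 / 4 ∧
        cocoreCurve κ δ (‖lamPart x‖ ^ 2) ≤ ‖muPart x‖ ^ 2))}

/-- **THE DOME** `{P < κ², 1 ≤ r², r² < 1 + g(δ(1 - P/κ²))}` — the part of the image on the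
`W`-side `{r ≥ 1}` (`= Π(T)`, V5 report §3.0). [cite: MilnorHCobordism1965, §3] -/
def dualDome (a κ δ : ℝ) : Set (EuclideanSpace ℝ (Fin 4)) :=
  {x | ‖lamPart x‖ ^ 2 < κ ^ 2 ∧ 1 ≤ ‖x‖ ^ 2 ∧
    ‖x‖ ^ 2 < 1 + gProfile a (δ * (1 - ‖lamPart x‖ ^ 2 / κ ^ 2))}

/-- On `N`, `P ≤ 3κ²/4` (in particular `N` misses the dual attaching sphere `{P = 1}`). [folklore] -/
theorem lamSq_le_of_mem_cocoreNbhd {κ δ : ℝ} (hδ : 0 < δ) {x : EuclideanSpace ℝ (Fin 4)}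
    (hx : x ∈ cocoreNbhd κ δ) : ‖lamPart x‖ ^ 2 ≤ 3 * κ ^ 2 / 4 := by
  rcases hx.2 with ⟨hQ, hP⟩ | ⟨-, hP, -⟩
  · have hs : ‖muPart x‖ ^ 2 / δ ≤ 1 / 2 := by rw [div_le_iff₀ hδ]; linarith
    have := pFun_le (κ := κ) hs
    nlinarith [sq_nonneg κ]
  · exact hP

/-- `N` is closed. [folklore] -/
theorem isClosed_cocoreNbhd (κ δ : ℝ) : IsClosed (cocoreNbhd κ δ) := by
  have hP : Continuous fun x : EuclideanSpace ℝ (Fin 4) => ‖lamPart x‖ ^ 2 :=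
    (contDiff_lamPart.continuous.norm).pow 2
  have hQ : Continuous fun x : EuclideanSpace ℝ (Fin 4) => ‖muPart x‖ ^ 2 :=
    (contDiff_muPart.continuous.norm).pow 2
  have hp : Continuous fun x : EuclideanSpace ℝ (Fin 4) => pFun κ (‖muPart x‖ ^ 2 / δ) :=
    (contDiff_pFun κ).continuous.comp (hQ.div_const _)
  have hc : Continuous fun x : EuclideanSpace ℝ (Fin 4) => cocoreCurve κ δ (‖lamPart x‖ ^ 2) :=
    (contDiff_cocoreCurve κ δ).continuous.comp hP
  refine (isClosed_le continuous_norm continuous_const).inter (IsClosed.union ?_ ?_)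
  · exact (isClosed_le hQ continuous_const).inter (isClosed_le hP hp)
  · exact (isClosed_le continuous_const hQ).inter ((isClosed_le hP continuous_const).inter
      (isClosed_le hc hQ))

/-- `‖x‖ ≤ 1 ↔ P + Q ≤ 1`. [folklore] -/
theorem norm_le_one_iff_parts (x : EuclideanSpace ℝ (Fin 4)) :
    ‖x‖ ≤ 1 ↔ ‖lamPart x‖ ^ 2 + ‖muPart x‖ ^ 2 ≤ 1 := by
  rw [← norm_sq_eq_lamPart_muPart]
  constructor
  · intro h; nlinarith [norm_nonneg x]
  · intro h; nlinarith [norm_nonneg x]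

/-- **`N` is a neighbourhood of the cocore disc in the handle**: `{r ≤ 1, P ≤ κ²/16} ⊆ N`.
[folklore] -/
theorem closedBall_inter_subset_cocoreNbhd {κ δ : ℝ} (hκ : 0 < κ) (hδ : 0 < δ) :
    {x : EuclideanSpace ℝ (Fin 4) | ‖x‖ ≤ 1 ∧ ‖lamPart x‖ ^ 2 ≤ κ ^ 2 / 16} ⊆ cocoreNbhd κ δ := by
  rintro x ⟨hx, hP⟩
  refine ⟨hx, ?_⟩
  rcases le_or_gt (‖muPart x‖ ^ 2) (δ / 2) with hQ | hQ
  · exact Or.inl ⟨hQ, hP.trans (pFun_ge (div_nonneg (sq_nonneg _) hδ.le))⟩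
  · refine Or.inr ⟨by linarith, by nlinarith [sq_nonneg κ], ?_⟩
    rw [cocoreCurve_of_le hκ (by nlinarith [sq_nonneg κ]), div_le_iff₀ (by positivity)]
    nlinarith

/-- The cocore disc `{P = 0, r ≤ 1}` lies in `N`. [folklore] -/
theorem mem_cocoreNbhd_of_lamPart_eq_zero {κ δ : ℝ} (hκ : 0 < κ) (hδ : 0 < δ)
    {x : EuclideanSpace ℝ (Fin 4)} (hx : ‖x‖ ≤ 1) (h0 : lamPart x = 0) : x ∈ cocoreNbhd κ δ :=
  closedBall_inter_subset_cocoreNbhd hκ hδ ⟨hx, by rw [h0, norm_zero, zero_pow two_ne_zero]; positivity⟩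

/-- **`N` meets the seam in `{r = 1, P ≤ 3κ²/4}`.** [folklore] -/
theorem mem_cocoreNbhd_iff_of_norm_eq_one {κ δ : ℝ} (hκ : 0 < κ) (hκ2 : κ ≤ 1 / 2) (hδ : 0 < δ)
    (hδ2 : δ ≤ 1 / 2) {x : EuclideanSpace ℝ (Fin 4)} (hx : ‖x‖ = 1) :
    x ∈ cocoreNbhd κ δ ↔ ‖lamPart x‖ ^ 2 ≤ 3 * κ ^ 2 / 4 := by
  refine ⟨lamSq_le_of_mem_cocoreNbhd hδ, fun hP => ⟨hx.le, Or.inr ⟨?_, hP, ?_⟩⟩⟩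
  · have h := norm_sq_eq_lamPart_muPart x
    rw [hx, one_pow] at h
    have : κ ^ 2 ≤ 1 / 4 := by nlinarith
    nlinarith
  · have h := norm_sq_eq_lamPart_muPart x
    rw [hx, one_pow] at h
    have := cocoreCurve_le_one_sub hκ hκ2 hδ.le hδ2 (P := ‖lamPart x‖ ^ 2)
    linarith

end Region

/-! ### §4 The model function `H` -/

section ModelH

/-- **The model function read in the quarter plane**:
`h(P, Q) = (1 - χ̄(Q/δ))(P - 𝓅(Q/δ)) + χ̄(Q/δ)(𝒸(P) - Q)`. [cite: MilnorHCobordism1965, §3] -/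
def modelHFun (κ δ P Q : ℝ) : ℝ :=
  (1 - slabCut (Q / δ)) * (P - pFun κ (Q / δ)) + slabCut (Q / δ) * (cocoreCurve κ δ P - Q)

/-- **THE MODEL FUNCTION `H`** of the pushed sub-handlebody: `H x = h(‖x_λ‖², ‖x_μ‖²)`; its
negative region in the handle is the cocore neighbourhood `N` minus its inner boundary, its zero
set is regular (`…DualHandleModelRegion.lean`). [cite: MilnorHCobordism1965, §3] -/
def modelH (κ δ : ℝ) (x : EuclideanSpace ℝ (Fin 4)) : ℝ :=
  modelHFun κ δ (‖lamPart x‖ ^ 2) (‖muPart x‖ ^ 2)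

/-- `P = ‖x_λ‖²` is smooth. [folklore] -/
theorem contDiff_lamNormSq : ContDiff ℝ ∞ fun x : EuclideanSpace ℝ (Fin 4) => ‖lamPart x‖ ^ 2 :=
  (contDiff_norm_sq ℝ).comp contDiff_lamPart

/-- `Q = ‖x_μ‖²` is smooth. [folklore] -/
theorem contDiff_muNormSq : ContDiff ℝ ∞ fun x : EuclideanSpace ℝ (Fin 4) => ‖muPart x‖ ^ 2 :=
  (contDiff_norm_sq ℝ).comp contDiff_muPart

/-- **`H` is smooth on `ℝ⁴`.** [folklore] -/
theorem contDiff_modelH (κ δ : ℝ) : ContDiff ℝ ∞ (modelH κ δ) := by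
  unfold modelH modelHFun
  have hq : ContDiff ℝ ∞ fun x : EuclideanSpace ℝ (Fin 4) => ‖muPart x‖ ^ 2 / δ :=
    contDiff_muNormSq.div_const _
  have hs : ContDiff ℝ ∞ fun x : EuclideanSpace ℝ (Fin 4) => slabCut (‖muPart x‖ ^ 2 / δ) :=
    contDiff_slabCut.comp hq
  exact ((contDiff_const.sub hs).mul (contDiff_lamNormSq.sub ((contDiff_pFun κ).comp hq))).add
    (hs.mul (((contDiff_cocoreCurve κ δ).comp contDiff_lamNormSq).sub contDiff_muNormSq))

/-- Swap slab: `h = P - 𝓅(Q/δ)` for `Q ≤ δ/4`. [folklore] -/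
theorem modelHFun_of_le {κ δ P Q : ℝ} (hδ : 0 < δ) (hQ : Q ≤ δ / 4) :
    modelHFun κ δ P Q = P - pFun κ (Q / δ) := by
  have : Q / δ ≤ 1 / 4 := by rw [div_le_iff₀ hδ]; linarith
  rw [modelHFun, slabCut_of_le this]; ring

/-- Upper zone: `h = 𝒸(P) - Q` for `Q ≥ δ/2`. [folklore] -/
theorem modelHFun_of_ge {κ δ P Q : ℝ} (hδ : 0 < δ) (hQ : δ / 2 ≤ Q) :
    modelHFun κ δ P Q = cocoreCurve κ δ P - Q := by
  have : 1 / 2 ≤ Q / δ := by rw [le_div_iff₀ hδ]; linarith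
  rw [modelHFun, slabCut_of_ge this]; ring

/-- **Line zone**: for `δ/4 ≤ Q` and `P ≤ κ²/2`,
`h = ((1 - χ̄(Q/δ)) κ²/δ + χ̄(Q/δ)) · (δP/κ² - Q)` — both blended functions are positive multiples
of `δP/κ² - Q`. [folklore] -/
theorem modelHFun_line {κ δ P Q : ℝ} (hκ : 0 < κ) (hδ : 0 < δ) (hQ : δ / 4 ≤ Q) (hP : P ≤ κ ^ 2 / 2) :
    modelHFun κ δ P Q =
      ((1 - slabCut (Q / δ)) * (κ ^ 2 / δ) + slabCut (Q / δ)) * (δ * P / κ ^ 2 - Q) := by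
  have hs : 1 / 4 ≤ Q / δ := by rw [le_div_iff₀ hδ]; linarith
  rw [modelHFun, pFun_of_ge κ hs, cocoreCurve_of_le hκ hP]
  field_simp

/-- The line-zone multiplier is positive. [folklore] -/
theorem lineMult_pos {κ δ : ℝ} (hκ : 0 < κ) (hδ : 0 < δ) (s : ℝ) :
    0 < (1 - slabCut s) * (κ ^ 2 / δ) + slabCut s := by
  have h0 := (slabCut_mem s).1
  have h1 := (slabCut_mem s).2
  have hk : 0 < κ ^ 2 / δ := by positivity
  rcases eq_or_lt_of_le h1 with h | h
  · rw [h]; norm_num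
  · nlinarith [mul_pos (sub_pos.2 h) hk]

/-- `H` in the swap slab `Q ≤ δ/4`. [folklore] -/
theorem modelH_of_le {κ δ : ℝ} (hδ : 0 < δ) {x : EuclideanSpace ℝ (Fin 4)} (hQ : ‖muPart x‖ ^ 2 ≤ δ / 4) :
    modelH κ δ x = ‖lamPart x‖ ^ 2 - pFun κ (‖muPart x‖ ^ 2 / δ) := by
  unfold modelH; exact modelHFun_of_le hδ hQ

/-- `H` in the upper zone `Q ≥ δ/2`. [folklore] -/
theorem modelH_of_ge {κ δ : ℝ} (hδ : 0 < δ) {x : EuclideanSpace ℝ (Fin 4)} (hQ : δ / 2 ≤ ‖muPart x‖ ^ 2) :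
    modelH κ δ x = cocoreCurve κ δ (‖lamPart x‖ ^ 2) - ‖muPart x‖ ^ 2 := by
  unfold modelH; exact modelHFun_of_ge hδ hQ

/-- **PLATEAU: `H = 1 - ‖x‖²` for `P ≥ 3κ²/4`, `Q ≥ δ/2`** (so the push of Z3 and the blend with the
seam height can be the identity there). [folklore] -/
theorem modelH_eq_one_sub_norm_sq {κ δ : ℝ} (hκ : 0 < κ) (hδ : 0 < δ) {x : EuclideanSpace ℝ (Fin 4)}
    (hP : 3 * κ ^ 2 / 4 ≤ ‖lamPart x‖ ^ 2) (hQ : δ / 2 ≤ ‖muPart x‖ ^ 2) :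
    modelH κ δ x = 1 - ‖x‖ ^ 2 := by
  rw [modelH_of_ge hδ hQ, cocoreCurve_of_ge hκ hP, norm_sq_eq_lamPart_muPart]; ring

/-- **`H ≤ 1 - ‖x‖²` on `Q ≥ δ/2`** (so `H < 0` on the `W`-side `{r > 1}` there, and `H ≤ 0` on the
dome). [folklore] -/
theorem modelH_le_one_sub_norm_sq {κ δ : ℝ} (hκ : 0 < κ) (hκ2 : κ ≤ 1 / 2) (hδ : 0 < δ) (hδ2 : δ ≤ 1 / 2)
    {x : EuclideanSpace ℝ (Fin 4)} (hQ : δ / 2 ≤ ‖muPart x‖ ^ 2) : modelH κ δ x ≤ 1 - ‖x‖ ^ 2 := by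
  rw [modelH_of_ge hδ hQ, norm_sq_eq_lamPart_muPart]
  have := cocoreCurve_le_one_sub hκ hκ2 hδ.le hδ2 (P := ‖lamPart x‖ ^ 2)
  linarith

/-- In the open line zone `δ/4 < Q < δ/2` with `κ²/2 < P` the function is positive, provided
`Q ≤ 𝒸(P)` (which holds for `‖x‖ ≤ 1` or for `P < 1 - δ/2`). [folklore] -/
theorem modelHFun_pos_of {κ δ P Q : ℝ} (hκ : 0 < κ) (hδ : 0 < δ) (hQ1 : δ / 4 < Q) (hQ2 : Q < δ / 2)
    (hP : κ ^ 2 / 2 < P) (hc : Q ≤ cocoreCurve κ δ P) : 0 < modelHFun κ δ P Q := by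
  have hs : 1 / 4 ≤ Q / δ := by rw [le_div_iff₀ hδ]; linarith
  have hs' : Q / δ < 1 / 2 := by rw [div_lt_iff₀ hδ]; linarith
  rw [modelHFun, pFun_of_ge κ hs]
  have h1 : 0 < 1 - slabCut (Q / δ) := sub_pos.2 (slabCut_lt_one hs')
  have h2 : 0 < P - κ ^ 2 * (Q / δ) := by
    have : κ ^ 2 * (Q / δ) < κ ^ 2 / 2 := by
      rw [mul_div_assoc']
      rw [div_lt_iff₀ hδ]; nlinarith [sq_nonneg κ, pow_pos hκ 2]
    linarith
  nlinarith [mul_pos h1 h2, mul_nonneg (slabCut_mem (Q / δ)).1 (sub_nonneg.2 hc)]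

/-- **Registered helper `helper_modelH_plateau` (brick (H) of T3b, sub-goal of NF6
`stub_steinRealisation`, wave 3, lead c5): on the plateau `‖x_λ‖² ≥ 3κ²/4`, `‖x_μ‖² ≥ δ/2` the model
function is `1 - ‖x‖²`.** [cite: MilnorHCobordism1965, §3] -/
theorem helper_modelH_plateau : ∀ {κ δ : ℝ}, 0 < κ → 0 < δ → ∀ (x : EuclideanSpace ℝ (Fin 4)), 3 * κ ^ 2 / 4 ≤ ‖Literature.Topology.FourManifolds.lamPart x‖ ^ 2 → δ / 2 ≤ ‖Literature.Topology.FourManifolds.muPart x‖ ^ 2 → Summit.SmoothPoincare4.SmoothPoincare4.Theorems.AcyclicBisectionExists.ModpBraidOrbits.modelH κ δ x = 1 - ‖x‖ ^ 2 :=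
  fun hκ hδ _ hP hQ => modelH_eq_one_sub_norm_sq hκ hδ hP hQ

end ModelH

end Summit.SmoothPoincare4.SmoothPoincare4.Theorems.AcyclicBisectionExists.ModpBraidOrbits

end
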